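/-
Copyright (c) 2026. All rights reserved.
Released under Apache 2.0 license as described in the file LICENSE.
Authors: abc-iut cell, statement-typer seat abc-iut-L4-t3 (wave 1; gen 6), continuing abc-iut-f-101's sufficiency files.
-/
import Literature.AnabelianGeometry.AbsoluteAnabelian.LogFrobeniusMonoTelecorePostcomp
import HarnessLib

/-!
# [AbsTopIII] Corollary 5.10 (iv)(c): the framed lifts at `𝒩⊢⊞_v` commute with PRE-composition (abc-iut-f-101's R1)

S. Mochizuki, *Topics in absolute anabelian geometry III: global reconstruction algorithms*,
J. Math. Sci. Univ. Tokyo 22 (2015) 939–1156 [MochizukiAbsTopIII2015]; manuscript (`paper:url-5493eb38cbb7`) Def 3.5 (ii)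
p. 75 (families of homotopies: the boundary set is closed under pre-composition with paths and
`ζ_{([γ₁]∘[ρ],[γ₂]∘[ρ])} = 𝒟_[ρ] ◁ ζ_{([γ₁],[γ₂])}`, §0 p. 26 (d)), Rmk 3.5.1 p. 78, Cor 5.10 (iv)(c) p. 148 (the contact
structure `ℋ_{An⊢}` generated by the `η⊢_{v,ν}` and the mono-analyticization homotopies).

PROOF-ONLY continuation (nothing restated) of abc-iut-f-101's sufficiency chain for the PRINT-FAITHFUL row
`Cor510MonoTelecorePinned` (`…Over`, `…Frames`, `…FrameIsos`, `…FrameLifts`, `…Postcomp`, and abc-iut-L4-t5's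
`DiagramRelativeFamilies`), item R1 of their HANDOFF (2026-08-26T16:42Z): the relative lifts `θAt` at the non-fully-faithful
vertices `𝒩⊢⊞_v` (`Θ_p ∘ Θ_q⁻¹` for two paths of one class `A_ν`) satisfy the PRE-composition law of Def 3.5 (ii):

* `ΘT_hom_app_precomp_heq`, `ΘL_hom_app_precomp_heq`, `Θ_hom_app_precomp_heq`, `Θ_inv_app_precomp_heq` — the frame
  isomorphism of `[ρ] ∘ p` at `x` is the frame isomorphism of `p` at `𝒟_[ρ](x)` followed by `ψ^{An⊢⊞}_{v,ν}` applied to the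
  structure isomorphism of `ρ` (Rmk 3.5.1: everything lies over the core);
* `θAt_precomp_heq` — **R1**: `θ([ρ]∘p, [ρ]∘q) ≍ 𝒟_[ρ] ◁ θ(p, q)`.

Refereed pre-IUT material; OUR constructions over a typed interface; nothing here bears on [IUTchIII] Cor. 3.12; no side taken.
-/

set_option autoImplicit false

universe u

open CategoryTheory Quiver

namespace Literature.AnabelianGeometry.AbsoluteAnabelian

namespace LogFrobeniusSetting

variable {Vmod : Type u} {isArc : Vmod → Bool} (L : LogFrobeniusSetting Vmod isArc)
  (hN : ∀ v : Vmod, L.monoN v ⋙ L.toEmono v ≅ L.toE v ⋙ L.monoAn)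
  (hψ : ∀ (w : Vmod) (j : {ν : LogVertex (isArc w) // ν.IsCross}),
    L.ψAnMono w j ⋙ L.forgetMono w ⋙ L.toEmono w ≅ L.κAnMono.inverse)

section Precomp

variable (hη : ∀ (v : Vmod) (ν : LogVertex (isArc v)) (hν : ν.IsCross),
  L.lam v ν ⋙ L.forget v ⋙ L.toE v ⋙ L.monoAn ⋙ L.κAnMono.functor ⋙ L.ψAnMono v ⟨ν, hν⟩ ≅ L.lam v ν ⋙ L.monoNplus v)

variable {v : Vmod} {ν : LogVertex (isArc v)} {hν : ν.IsCross} {a c : (monoTeleShape Vmod isArc).Vertex}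

/-! ### HEq bookkeeping -/

/-- `(eqToHom ≫ f) ≫ g ≍ f ≫ g`. [folklore] -/
private theorem eqToHom_comp_comp_heq'' {C : Type*} [Category C] {W X Y Z : C} (h : W = X) (f : X ⟶ Y) (g : Y ⟶ Z) :
    (eqToHom h ≫ f) ≫ g ≍ f ≫ g := by
  subst h
  simp

/-- `f ≫ eqToHom ≫ g ≍ f' ≫ eqToHom ≫ g'` when `f ≍ f'`, `g ≍ g'`. [folklore] -/
private theorem comp_eqToHom_comp_heq₂ {C : Type*} [Category C] {W X Y Z W' X' Y' Z' : C} {f : W ⟶ X} {f' : W' ⟶ X'}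
    (h : X = Y) (h' : X' = Y') {g : Y ⟶ Z} {g' : Y' ⟶ Z'} (hW : W = W') (hX : X = X') (hZ : Z = Z') (hf : f ≍ f')
    (hg : g ≍ g') : f ≫ eqToHom h ≫ g ≍ f' ≫ eqToHom h' ≫ g' := by
  subst hW hX hZ h h'
  cases hf
  cases hg
  rfl

/-- inverses of isomorphisms with `HEq` forward maps are `HEq`. [folklore] -/
private theorem iso_inv_heq_of_hom_heq {C : Type*} [Category C] {A B A' B' : C} (hA : A = A') (hB : B = B')
    {I : A ≅ B} {J : A' ≅ B'} (h : I.hom ≍ J.hom) : I.inv ≍ J.inv := by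
  subst hA hB
  rw [Iso.ext (eq_of_heq h)]

/-- the frame isomorphism `ΘT` transported along an equality of paths. [cite: MochizukiAbsTopIII2015, Remark 3.5.1 p.78] -/
theorem ΘT_hom_app_heq_of_eq {p p' : Path a (nmonoPlusVx v)} (h : p = p') (wt : TelWit v ν hν p)
    (wt' : TelWit v ν hν p') (x : L.monoTeleDiagram.obj a) :
    (L.ΘT hN hψ wt).hom.app x ≍ (L.ΘT hN hψ wt').hom.app x := by
  subst h
  obtain rfl : wt = wt' := TelWit.eq_of wt wt'
  rfl

/-! ### The frame isomorphisms under pre-composition -/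

/-- **`ΘT` under pre-composition** (Rmk 3.5.1): for a path `p` ending with the telecore edge `φ^{An⊢⊞}_{v,ν}` and a prefix
`[ρ] : c ⟶ a`, the frame isomorphism of `[ρ] ∘ p` at `x` is that of `p` at `𝒟_[ρ](x)` followed by `ψ^{An⊢⊞}_{v,ν}` of the
structure isomorphism of `[ρ]`. [cite: MochizukiAbsTopIII2015, Remark 3.5.1 p.78] -/
theorem ΘT_hom_app_precomp_heq (r : Path c a) {p : Path a (nmonoPlusVx v)} (wt : TelWit v ν hν p)
    (wt' : TelWit v ν hν (r.comp p)) (x : L.monoTeleDiagram.obj c) :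
    (L.ΘT hN hψ wt').hom.app x ≍
      (L.ΘT hN hψ wt).hom.app ((L.monoTeleDiagram.pathFunctor r).obj x) ≫
        (L.ψAnMono v ⟨ν, hν⟩).map (((L.monoTeleOver hN hψ).pathIso r).hom.app x) := by
  obtain ⟨R, rfl⟩ := wt
  obtain rfl : wt' = ⟨r.comp R, rfl⟩ := TelWit.eq_of wt' ⟨r.comp R, rfl⟩
  rw [ΘT_hom_app, ΘT_hom_app]
  have k₁ : ((L.monoTeleDiagram.pathFunctor (r.comp R)) ⋙ (L.monoTeleOver hN hψ).N (coreVx Vmod isArc)).obj x =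
      ((L.monoTeleDiagram.pathFunctor R) ⋙ (L.monoTeleOver hN hψ).N (coreVx Vmod isArc)).obj
        ((L.monoTeleDiagram.pathFunctor r).obj x) := by
    rw [DiagramOfCategories.pathFunctor_comp]; rfl
  refine (eqToHom_comp_heq _ _).trans ?_
  refine (map_heq' (L.ψAnMono v ⟨ν, hν⟩) k₁ rfl (L.pathIso_comp_hom_app_heq hN hψ r R x)).trans ?_
  rw [Functor.map_comp]
  exact (eqToHom_comp_comp_heq'' _ _ _).symm

/-- **`ΘL` under pre-composition**: the same for a path ending with `γ⁰_{v,ν}` (through `(η⊢_{v,ν})⁻¹`).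
[cite: MochizukiAbsTopIII2015, Cor 5.10 (iv)(c) p.148] -/
theorem ΘL_hom_app_precomp_heq (r : Path c a) {p : Path a (nmonoPlusVx v)} (wl : LamWit v ν hν p)
    (wl' : LamWit v ν hν (r.comp p)) (x : L.monoTeleDiagram.obj c) :
    (L.ΘL hN hψ hη wl').hom.app x ≍
      (L.ΘL hN hψ hη wl).hom.app ((L.monoTeleDiagram.pathFunctor r).obj x) ≫
        (L.ψAnMono v ⟨ν, hν⟩).map (((L.monoTeleOver hN hψ).pathIso r).hom.app x) := by
  obtain ⟨R, rfl⟩ := wl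
  obtain rfl : wl' = ⟨r.comp R, rfl⟩ := LamWit.eq_of wl' ⟨r.comp R, rfl⟩
  rw [ΘL_hom_app, ΘL_hom_app]
  -- the telecore-ended auxiliary paths and their frame isomorphisms
  have hpath : ((r.comp R).comp (gammaOnePrefix v ν hν)).cons (telE v ν hν) =
      r.comp ((R.comp (gammaOnePrefix v ν hν)).cons (telE v ν hν)) := by
    rw [Path.comp_cons, Path.comp_assoc]
  have hT : (L.ΘT hN hψ (p := ((r.comp R).comp (gammaOnePrefix v ν hν)).cons (telE v ν hν))
        ⟨(r.comp R).comp (gammaOnePrefix v ν hν), rfl⟩).hom.app x ≍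
      (L.ΘT hN hψ (p := (R.comp (gammaOnePrefix v ν hν)).cons (telE v ν hν))
          ⟨R.comp (gammaOnePrefix v ν hν), rfl⟩).hom.app ((L.monoTeleDiagram.pathFunctor r).obj x) ≫
        (L.ψAnMono v ⟨ν, hν⟩).map (((L.monoTeleOver hN hψ).pathIso r).hom.app x) :=
    (L.ΘT_hom_app_heq_of_eq hN hψ hpath _
        (⟨r.comp (R.comp (gammaOnePrefix v ν hν)), rfl⟩ :
          TelWit v ν hν (r.comp ((R.comp (gammaOnePrefix v ν hν)).cons (telE v ν hν)))) x).trans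
      (L.ΘT_hom_app_precomp_heq hN hψ r ⟨R.comp (gammaOnePrefix v ν hν), rfl⟩ _ x)
  -- objects
  have k₀ : (L.monoTeleDiagram.pathFunctor (r.comp R)).obj x =
      (L.monoTeleDiagram.pathFunctor R).obj ((L.monoTeleDiagram.pathFunctor r).obj x) :=
    Functor.congr_obj (DiagramOfCategories.pathFunctor_comp _ r R) x
  have hη' : (hη v ν hν).inv.app ((L.monoTeleDiagram.pathFunctor (r.comp R)).obj x) ≍
      (hη v ν hν).inv.app ((L.monoTeleDiagram.pathFunctor R).obj ((L.monoTeleDiagram.pathFunctor r).obj x)) :=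
    app_heq' _ k₀
  have kZ : ((L.monoTeleOver hN hψ).N c ⋙ L.ψAnMono v ⟨ν, hν⟩).obj x =
      (L.ψAnMono v ⟨ν, hν⟩).obj (((L.monoTeleOver hN hψ).N c).obj x) := rfl
  -- left: strip the leading `eqToHom`; compare the middles; right: reassociate and strip
  refine (eqToHom_comp_heq _ _).trans ?_
  refine (comp_eqToHom_comp_heq₂ _
    (Functor.congr_obj (L.pathFunctor_comp_gammaOne ν hν R) ((L.monoTeleDiagram.pathFunctor r).obj x)).symm
    (by rw [k₀]) (by rw [k₀]; rfl) kZ hη' hT).trans ?_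
  symm
  erw [Category.assoc, Category.assoc, Category.assoc]
  exact eqToHom_comp_heq _ _

/-- **the frame isomorphism under pre-composition**, either kind of witness. [cite: MochizukiAbsTopIII2015, Remark 3.5.1 p.78] -/
theorem Θ_hom_app_precomp_heq (r : Path c a) {p : Path a (nmonoPlusVx v)} (w : TelWit v ν hν p ⊕ LamWit v ν hν p)
    (w' : TelWit v ν hν (r.comp p) ⊕ LamWit v ν hν (r.comp p)) (x : L.monoTeleDiagram.obj c) :
    (L.Θ hN hψ hη w').hom.app x ≍
      (L.Θ hN hψ hη w).hom.app ((L.monoTeleDiagram.pathFunctor r).obj x) ≫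
        (L.ψAnMono v ⟨ν, hν⟩).map (((L.monoTeleOver hN hψ).pathIso r).hom.app x) := by
  rcases w with ⟨R, rfl⟩ | ⟨R, rfl⟩
  · rw [L.Θ_eq hN hψ hη w' (.inl ⟨r.comp R, rfl⟩)]
    exact L.ΘT_hom_app_precomp_heq hN hψ r ⟨R, rfl⟩ ⟨r.comp R, rfl⟩ x
  · rw [L.Θ_eq hN hψ hη w' (.inr ⟨r.comp R, rfl⟩)]
    exact L.ΘL_hom_app_precomp_heq hN hψ hη r ⟨R, rfl⟩ ⟨r.comp R, rfl⟩ x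

/-- the inverse frame isomorphism under pre-composition. [cite: MochizukiAbsTopIII2015, Remark 3.5.1 p.78] -/
theorem Θ_inv_app_precomp_heq (r : Path c a) {p : Path a (nmonoPlusVx v)} (w : TelWit v ν hν p ⊕ LamWit v ν hν p)
    (w' : TelWit v ν hν (r.comp p) ⊕ LamWit v ν hν (r.comp p)) (x : L.monoTeleDiagram.obj c) :
    (L.Θ hN hψ hη w').inv.app x ≍
      (L.ψAnMono v ⟨ν, hν⟩).map (((L.monoTeleOver hN hψ).pathIso r).inv.app x) ≫
        (L.Θ hN hψ hη w).inv.app ((L.monoTeleDiagram.pathFunctor r).obj x) :=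
  iso_inv_heq_of_hom_heq (Functor.congr_obj (DiagramOfCategories.pathFunctor_comp _ r p) x) rfl
    (I := (L.Θ hN hψ hη w').app x)
    (J := (L.Θ hN hψ hη w).app ((L.monoTeleDiagram.pathFunctor r).obj x) ≪≫
      (L.ψAnMono v ⟨ν, hν⟩).mapIso (((L.monoTeleOver hN hψ).pathIso r).app x))
    (L.Θ_hom_app_precomp_heq hN hψ hη r w w' x)

/-! ### R1: the relative lift commutes with pre-composition -/

/-- **R1 (Def 3.5 (ii), pre-composition law for the framed lifts at `𝒩⊢⊞_v`)**: for related paths `p, q : a ⟶ 𝒩⊢⊞_v` and a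
prefix `[ρ] : c ⟶ a`, `θ([ρ]∘p, [ρ]∘q) ≍ 𝒟_[ρ] ◁ θ(p, q)` — the structure isomorphisms of `[ρ]` cancel between `Θ_{[ρ]∘p}`
and `Θ_{[ρ]∘q}⁻¹`. [cite: MochizukiAbsTopIII2015, Definition 3.5 (ii) p.75] -/
theorem θAt_precomp_heq (r : Path c a) {p q : Path a (nmonoPlusVx v)} (hr : MRel p q)
    (hr' : MRel (r.comp p) (r.comp q)) :
    L.θAt hN hψ hη hr' ≍ Functor.whiskerLeft (L.monoTeleDiagram.pathFunctor r) (L.θAt hN hψ hη hr) := by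
  obtain ⟨ν₀, hν₀, hp, hq⟩ := (mrel_nmonoPlus_iff p q).mp hr
  have hp' : InA v ν₀ hν₀ (r.comp p) := hp.precomp r
  have hq' : InA v ν₀ hν₀ (r.comp q) := hq.precomp r
  rw [L.θAt_eq hN hψ hη hr hp.wit hq.wit, L.θAt_eq hN hψ hη hr' hp'.wit hq'.wit]
  refine natTrans_heq_of_app (DiagramOfCategories.pathFunctor_comp _ _ _) (DiagramOfCategories.pathFunctor_comp _ _ _)
    fun x => ?_
  rw [NatTrans.comp_app, Functor.whiskerLeft_app, NatTrans.comp_app]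
  have e₁ := L.Θ_hom_app_precomp_heq hN hψ hη r hp.wit hp'.wit x
  have e₂ := L.Θ_inv_app_precomp_heq hN hψ hη r hq.wit hq'.wit x
  refine (heq_comp (Functor.congr_obj (DiagramOfCategories.pathFunctor_comp _ r p) x) rfl
    (Functor.congr_obj (DiagramOfCategories.pathFunctor_comp _ r q) x) e₁ e₂).trans ?_
  -- `(Θ_p ∘ ψ(π_ρ)) ∘ (ψ(π_ρ)⁻¹ ∘ Θ_q⁻¹) = Θ_p ∘ Θ_q⁻¹`
  apply heq_of_eq
  erw [Category.assoc, ← Category.assoc ((L.ψAnMono v ⟨ν₀, hν₀⟩).map _) ((L.ψAnMono v ⟨ν₀, hν₀⟩).map _),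
    ← Functor.map_comp, Iso.hom_inv_id_app, Functor.map_id]
  erw [Category.id_comp]
  rfl

end Precomp

end LogFrobeniusSetting

end Literature.AnabelianGeometry.AbsoluteAnabelian
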